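import Mathlib
import HarnessLib

/-!
# `KickFairRelEquilibriumMeso`, line `kinetic-window-cut` (rev 5) — the abstract count behind CPL:
# at most `|K| · G · (P + F)` ordered close pairs

Prover file (`--supports stmt-AtomisticToContinuum-15177`, wave 1 of lead c8) for the registered stub
`closePair_abstract_count_le` of the LONG-FLIGHT window cut of the crux
`Summit.AtomisticToContinuum.HydrodynamicLimit.Theses.InformationPercolationEngine.KickFairRelEquilibriumMeso`.
It is the law-independent, dynamics-free combinatorial core of CPL (`ClosePairCountLong`, the close-pair count of the
long-flight window cut): PURE finite combinatorics, imports `Mathlib` only.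

Setting. A finite set `K` of kicks `k`, each carrying a sphere `sphere k : Fin (N+1)`, an integer grid index `idx k` and an
integer window `win k`; a relation `Near k k'` and a predicate `Fast k'`. Hypotheses: (1) `(sphere, idx)` is injective on
`K` (distinct long kicks of one sphere have distinct grid indices); (2) the grid index of a kick in window `v` lies in the
integer interval `[lo v, hi v]`, (3) which has at most `G` points; (4) PACKING: for a fixed kick `k` and grid index `γ` at
most `P` spheres have a kick in `k`'s window at grid index `γ` that is near `k`; (5) ENERGY: for every window `v` and grid
index `γ` at most `F` spheres have a fast kick in window `v` at grid index `γ`. Conclusion (`closePair_abstract_count_le`):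

  `#{(k, k') ∈ K × K : win k = win k' ∧ (Near k k' ∨ Fast k')} ≤ |K| · (G · (P + F))`.

Proof. Fix `k ∈ K` and count the fibre `{k' : win k' = win k ∧ (Near k k' ∨ Fast k')}`: it maps by
`k' ↦ (sphere k', idx k')` INJECTIVELY (1) into `⋃_{γ ∈ [lo (win k), hi (win k)]} (A_γ ∪ B_γ) × {γ}` (2), where `A_γ`, `B_γ`
are the sphere sets of (4) and (5) (with `v = win k`); this union has at most `Σ_γ (P + F) ≤ G (P + F)` elements
(`Finset.card_biUnion_le`, `Int.card_Icc`, (3)) — the grid-injection count `card_le_toNat_mul_of_grid`. Summing the fibres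
over the first coordinate (`Finset.card_le_mul_card_image_of_maps_to`) gives the claim. In CPL, `K` is the set of
long-flight kicks (pairs in different windows are not counted), `idx` the index of the grid time preceding the collision,
`G = ⌊2A⌋ + 3`, `P` the torus packing number and `F` the kinetic-energy bound on the number of fast spheres; that
instantiation is the lead's assembly file, not this one.
-/

open scoped Classical

namespace Summit.AtomisticToContinuum.HydrodynamicLimit.Theorems.KickFairRelEquilibriumMesoLine

/-- **Grid-injection count.** If `k ↦ (sphere k, idx k)` is injective on a finite set `S`, every `idx k`, `k ∈ S`, lies in
the integer interval `[a, b]`, and `sphere k ∈ A (idx k)` for a family of finite sets `A γ` of cardinality `≤ M` each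
(`γ ∈ [a, b]`), then `#S ≤ #[a, b] · M = (b + 1 - a).toNat · M`: `S` injects into `⋃_{γ ∈ [a,b]} A γ × {γ}`. [folklore] -/
theorem card_le_toNat_mul_of_grid {β σ : Type*} (S : Finset β) (sphere : β → σ) (idx : β → ℤ) (A : ℤ → Finset σ)
    (a b : ℤ) (M : ℕ) (hinj : ∀ k ∈ S, ∀ k' ∈ S, sphere k = sphere k' → idx k = idx k' → k = k')
    (hrange : ∀ k ∈ S, a ≤ idx k ∧ idx k ≤ b) (hmem : ∀ k ∈ S, sphere k ∈ A (idx k))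
    (hA : ∀ γ ∈ Finset.Icc a b, (A γ).card ≤ M) : S.card ≤ (b + 1 - a).toNat * M := by
  calc S.card ≤ ((Finset.Icc a b).biUnion fun γ => A γ ×ˢ ({γ} : Finset ℤ)).card := by
        refine Finset.card_le_card_of_injOn (fun k => (sphere k, idx k)) (fun k hk => ?_) fun k hk k' hk' h => ?_
        · exact Finset.mem_coe.2 (Finset.mem_biUnion.2 ⟨idx k, Finset.mem_Icc.2 (hrange k hk),
            Finset.mem_product.2 ⟨hmem k hk, Finset.mem_singleton_self _⟩⟩)
        · obtain ⟨hs, hi⟩ := Prod.ext_iff.1 h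
          exact hinj k hk k' hk' hs hi
    _ ≤ ∑ γ ∈ Finset.Icc a b, (A γ ×ˢ ({γ} : Finset ℤ)).card := Finset.card_biUnion_le
    _ ≤ ∑ _γ ∈ Finset.Icc a b, M := Finset.sum_le_sum fun γ hγ => by
        rw [Finset.card_product, Finset.card_singleton, mul_one]
        exact hA γ hγ
    _ = (b + 1 - a).toNat * M := by rw [Finset.sum_const, smul_eq_mul, Int.card_Icc]

/-- **The abstract close-pair count (stub `closePair_abstract_count_le` of the long-flight window cut).** Kicks `k ∈ K`
carry a sphere `sphere k`, a grid index `idx k` and a window `win k`. If (1) `(sphere, idx)` is injective on `K`, (2) the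
grid index of a kick in window `v` lies in `[lo v, hi v]`, (3) an interval of at most `G` integers, (4) for every kick `k`
and grid index `γ` at most `P` spheres have a kick near `k` in `k`'s window at grid index `γ`, and (5) for every window `v`
and grid index `γ` at most `F` spheres have a fast kick in window `v` at grid index `γ`, then the number of ORDERED pairs
`(k, k') ∈ K × K` in a common window with `k'` near `k` or fast is at most `|K| · (G · (P + F))`. [folklore] -/
theorem closePair_abstract_count_le : ∀ (α : Type) (K : Finset α) (N : ℕ) (sphere : α → Fin (N + 1))
    (idx win : α → ℤ) (Near : α → α → Prop) (Fast : α → Prop) (lo hi : ℤ → ℤ) (G P F : ℕ),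
    (∀ k ∈ K, ∀ k' ∈ K, sphere k = sphere k' → idx k = idx k' → k = k') →
    (∀ k ∈ K, lo (win k) ≤ idx k ∧ idx k ≤ hi (win k)) →
    (∀ v : ℤ, hi v - lo v + 1 ≤ (G : ℤ)) →
    (∀ k ∈ K, ∀ γ : ℤ, ((Finset.univ.filter fun s : Fin (N + 1) =>
        ∃ k' ∈ K, sphere k' = s ∧ idx k' = γ ∧ win k' = win k ∧ Near k k').card ≤ P)) →
    (∀ v γ : ℤ, ((Finset.univ.filter fun s : Fin (N + 1) =>
        ∃ k' ∈ K, sphere k' = s ∧ idx k' = γ ∧ win k' = v ∧ Fast k').card ≤ F)) →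
    ((K ×ˢ K).filter fun kk : α × α => win kk.1 = win kk.2 ∧ (Near kk.1 kk.2 ∨ Fast kk.2)).card
      ≤ K.card * (G * (P + F)) := by
  intro α K N sphere idx win Near Fast lo hi G P F hinj hrange hG hP hF
  -- the count of one fibre: kicks `kk.2` in the window of `k = kk.1`, near `k` or fast
  have hfib : ∀ k ∈ K, ∀ S : Finset (α × α),
      (∀ kk ∈ S, kk.2 ∈ K ∧ kk.1 = k ∧ win kk.2 = win k ∧ (Near k kk.2 ∨ Fast kk.2)) →
      S.card ≤ G * (P + F) := by
    intro k hk S hS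
    refine le_trans (card_le_toNat_mul_of_grid S (fun kk => sphere kk.2) (fun kk => idx kk.2)
      (fun γ => (Finset.univ.filter fun s : Fin (N + 1) =>
          ∃ k' ∈ K, sphere k' = s ∧ idx k' = γ ∧ win k' = win k ∧ Near k k') ∪
        (Finset.univ.filter fun s : Fin (N + 1) =>
          ∃ k' ∈ K, sphere k' = s ∧ idx k' = γ ∧ win k' = win k ∧ Fast k'))
      (lo (win k)) (hi (win k)) (P + F) ?_ ?_ ?_ ?_)
      (Nat.mul_le_mul_right _ (Int.toNat_le.2 (by linarith [hG (win k)])))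
    · -- injectivity of `kk ↦ (sphere kk.2, idx kk.2)` on the fibre
      intro kk hkk ll hll hs hi
      obtain ⟨hk2, hk1, -, -⟩ := hS kk hkk
      obtain ⟨hl2, hl1, -, -⟩ := hS ll hll
      exact Prod.ext (hk1.trans hl1.symm) (hinj kk.2 hk2 ll.2 hl2 hs hi)
    · -- the grid indices of the fibre lie in `[lo (win k), hi (win k)]`
      intro kk hkk
      obtain ⟨hk2, -, hw, -⟩ := hS kk hkk
      have h := hrange kk.2 hk2
      rw [hw] at h
      exact h
    · -- the sphere of a fibre element is a near or a fast sphere at its grid index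
      intro kk hkk
      obtain ⟨hk2, -, hw, hnf⟩ := hS kk hkk
      rcases hnf with h | h
      · exact Finset.mem_union_left _ (Finset.mem_filter.2 ⟨Finset.mem_univ _, kk.2, hk2, rfl, rfl, hw, h⟩)
      · exact Finset.mem_union_right _ (Finset.mem_filter.2 ⟨Finset.mem_univ _, kk.2, hk2, rfl, rfl, hw, h⟩)
    · -- packing and energy
      intro γ _
      exact (Finset.card_union_le _ _).trans (add_le_add (hP k hk γ) (hF (win k) γ))
  -- sum the fibres over the first coordinate
  rw [mul_comm]
  refine Finset.card_le_mul_card_image_of_maps_to (f := Prod.fst)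
    (fun kk hkk => (Finset.mem_product.1 (Finset.mem_filter.1 hkk).1).1) _ fun k hk => hfib k hk _ ?_
  intro kk hkk
  simp only [Finset.mem_filter, Finset.mem_product] at hkk
  obtain ⟨⟨⟨-, hk2⟩, hw, hnf⟩, rfl⟩ := hkk
  exact ⟨hk2, rfl, hw.symm, hnf⟩

end Summit.AtomisticToContinuum.HydrodynamicLimit.Theorems.KickFairRelEquilibriumMesoLine
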